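import Mathlib
import Literature.Computability.AlgebraicComplexity.MatrixMultiplicationExponent
import Literature.Computability.AlgebraicComplexity.AlderStrassen
import Summits.MatrixMultiplication.MatrixMultiplication.Theorems.FidelityWitnessesLinearDefectLawStubFreeUnitProduct

/-!
# `FidelityWitnesses.LinearDefectLaw`, line `border-singular-values`: `stub_freeUnitProductDet`

Support file for crux item `stmt-MatrixMultiplication-14039`
(`Summit.MatrixMultiplication.MatrixMultiplication.Theses.FidelityWitnesses.LinearDefectLaw`), line
`border-singular-values` (reshape r2), registered stub `stub_freeUnitProductDet` — THE FREE REGIME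
EXTENDED BY ONE RUNG, `r ≤ 2n − 1` for `n ≥ 2`.

Slots: `S a b c` with `a = (κ,ν)` the output slot, `b = (κ,μ)`, `c = (μ,ν)`, all in `Fin n × Fin n`;
`T := matMulTensor ℂ n n n`, `T a b c = [a.1 = b.1 ∧ b.2 = c.1 ∧ a.2 = c.2]`.

* `stub_freeUnitProductDet` — for `2 ≤ n`, `r + 1 ≤ 2n` and EVERY tensor `S` of rank `≤ r` there are
  unit vectors `x y z : Fin n × Fin n → ℂ` with `Σ S a b c · x a · y b · z c = 0` and
  `Σ T a b c · x a · y b · z c = 1`.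

Proof. For `r + 2 ≤ 2n` this is the landed sibling `FreeUnitProduct.stub_freeUnitProduct`. In the
remaining case `r = 2n − 1 ≥ n` write `S = Σ_{l < r} w_l ⊗ u_l ⊗ v_l`
(`exists_eq_sum_triad_of_tensorRank_le`) and evaluate on the ROTATED UNIT PRODUCT `x (κ,ν) := p κ q ν`,
`y (κ,μ) := conj (p κ) s μ`, `z (μ,ν) := conj (s μ) conj (q ν)` of unit vectors `p q s : Fin n → ℂ`:
`T ↦ 1` (`ev_matMulTensor`), `S ↦ Σ_l A_l B_l C_l` (`ev_sum_triad`) with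
`A_l = Σ_κ (Σ_ν w_l (κ,ν) q ν) p κ` and `B_l = Σ_μ (Σ_κ u_l (κ,μ) conj (p κ)) s μ`.
THE DETERMINANT STEP kills the first `n` factors `A_l`, `l < n`, at once: with two distinct basis
directions `ν₀ ≠ ν₁` (`n ≥ 2`) and the `n × n` matrices `N_ε l κ := w_l (κ, ν_ε)`, some nontrivial
combination `a N₀ + b N₁` has a nonzero kernel vector `p₀` (`exists_combination_mulVec_eq_zero`: if
`N₁` is singular take `(a,b) = (0,1)`, else an eigenvector of `N₁⁻¹ N₀` — `Module.End.exists_eigenvalue`,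
`ℂ` algebraically closed); with `q₀ := a e_{ν₀} + b e_{ν₁} ≠ 0` this says `A_l (p₀, q₀) = 0` for all
`l < n`, and the relations survive normalising `p₀`, `q₀` to unit vectors (`exists_unit_mul`). The
remaining `r − n ≤ n − 1 < n` indices give `< n` linear functionals `B_l` in `s`, killed by a unit `s`
(`FreeUnitProduct.exists_unit_orth`). Every summand `A_l B_l C_l` then vanishes.
-/

set_option linter.dupNamespace false

namespace Summit.MatrixMultiplication.MatrixMultiplication.Theorems.LinearDefectLaw.FreeUnitProductDet

open scoped BigOperators ComplexConjugate Matrix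
open Literature.Computability.AlgebraicComplexity
open Summit.MatrixMultiplication.MatrixMultiplication.Theorems.LinearDefectLaw.FreeUnitProduct

/-! ## The determinant step -/

/-- Two complex `n × n` matrices, `0 < n`, have a nontrivial linear combination `a N₀ + b N₁` with a
nonzero kernel vector: if `N₁` is singular take `(a, b) = (0, 1)` (`Matrix.exists_mulVec_eq_zero_iff`),
otherwise `(1, -c)` with `c` an eigenvalue of `N₁⁻¹ N₀` (`Module.End.exists_eigenvalue`). -/
theorem exists_combination_mulVec_eq_zero {n : ℕ} (hn : 0 < n) (N₀ N₁ : Matrix (Fin n) (Fin n) ℂ) :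
    ∃ (a b : ℂ) (v : Fin n → ℂ), (a ≠ 0 ∨ b ≠ 0) ∧ v ≠ 0 ∧ (a • N₀ + b • N₁) *ᵥ v = 0 := by
  by_cases h : N₁.det = 0
  · obtain ⟨v, hv, hv0⟩ := Matrix.exists_mulVec_eq_zero_iff.2 h
    exact ⟨0, 1, v, Or.inr one_ne_zero, hv, by rw [zero_smul, zero_add, one_smul, hv0]⟩
  · have hU : IsUnit N₁.det := isUnit_iff_ne_zero.2 h
    haveI : Nonempty (Fin n) := ⟨⟨0, hn⟩⟩
    obtain ⟨c, hc⟩ := Module.End.exists_eigenvalue (Matrix.toLin' (N₁⁻¹ * N₀))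
    obtain ⟨v, hv⟩ := hc.exists_hasEigenvector
    have hv1 : (N₁⁻¹ * N₀) *ᵥ v = c • v := by
      have h2 := hv.apply_eq_smul
      rwa [Matrix.toLin'_apply] at h2
    have hv2 : N₀ *ᵥ v = c • N₁ *ᵥ v := by
      have h3 : N₁ *ᵥ ((N₁⁻¹ * N₀) *ᵥ v) = N₀ *ᵥ v := by
        rw [Matrix.mulVec_mulVec, Matrix.mul_nonsing_inv_cancel_left N₁ N₀ hU]
      rw [← h3, hv1, Matrix.mulVec_smul]
    refine ⟨1, -c, v, Or.inl one_ne_zero, hv.2, ?_⟩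
    rw [Matrix.add_mulVec, Matrix.smul_mulVec, Matrix.smul_mulVec, one_smul, hv2, neg_smul,
      add_neg_cancel]

/-- A nonzero vector of `ℂⁿ` has a unit multiple (`Σ_κ ‖c v κ‖² = 1` for `c = 1/√(Σ‖v κ‖²)`). -/
theorem exists_unit_mul {n : ℕ} {v : Fin n → ℂ} (hv : v ≠ 0) :
    ∃ c : ℂ, ∑ κ, ‖c * v κ‖ ^ 2 = 1 := by
  have hpos : 0 < ∑ κ, ‖v κ‖ ^ 2 := by
    obtain ⟨κ, hκ⟩ : ∃ κ, v κ ≠ 0 := by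
      by_contra h
      push Not at h
      exact hv (funext h)
    exact lt_of_lt_of_le (by positivity) (Finset.single_le_sum (f := fun κ => ‖v κ‖ ^ 2)
      (fun i _ => by positivity) (Finset.mem_univ κ))
  set N : ℝ := Real.sqrt (∑ κ, ‖v κ‖ ^ 2) with hN
  have hNpos : 0 < N := Real.sqrt_pos.2 hpos
  have hN2 : N ^ 2 = ∑ κ, ‖v κ‖ ^ 2 := Real.sq_sqrt hpos.le
  refine ⟨((N : ℂ))⁻¹, ?_⟩
  have h : ∀ κ, ‖((N : ℂ))⁻¹ * v κ‖ ^ 2 = ‖v κ‖ ^ 2 / N ^ 2 := fun κ => by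
    rw [norm_mul, norm_inv, Complex.norm_real, Real.norm_of_nonneg hNpos.le, mul_pow, inv_pow]
    ring
  simp only [h]
  rw [← Finset.sum_div, ← hN2]
  exact div_self (pow_pos hNpos 2).ne'

/-! ## The stub -/

/-- stub `stub_freeUnitProductDet` of line `border-singular-values` (reshape r2) for crux
`LinearDefectLaw` (stmt-MatrixMultiplication-14039): for n ≥ 2 and r ≤ 2n − 1 every rank-≤ r tensor is
annihilated by a rotated unit product of ⟨n,n,n⟩ (kernel counting plus one determinant). Precisely: for
`2 ≤ n`, `r + 1 ≤ 2n` and `tensorRank S ≤ r` there are unit vectors `x y z : Fin n × Fin n → ℂ` with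
`Σ S a b c x a y b z c = 0` and `Σ ⟨n,n,n⟩ a b c x a y b z c = 1`; the witnesses are `x = p ⊗ q`,
`y = p̄ ⊗ s`, `z = s̄ ⊗ q̄` with `(p, q)` a unit solution of the `n` bilinear equations `A_l = 0`, `l < n`
(one singular combination of two `n × n` matrices) and `s` a unit vector in the common kernel of the
`< n` functionals `B_l`, `l ≥ n`. -/
theorem stub_freeUnitProductDet :
    ∀ (n r : ℕ) (S : Fin n × Fin n → Fin n × Fin n → Fin n × Fin n → ℂ), 2 ≤ n → r + 1 ≤ 2 * n →
      tensorRank S ≤ r →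
      ∃ x y z : Fin n × Fin n → ℂ, (∑ i, ‖x i‖ ^ 2) = 1 ∧ (∑ i, ‖y i‖ ^ 2) = 1 ∧ (∑ i, ‖z i‖ ^ 2) = 1 ∧
        (∑ a, ∑ b, ∑ c, S a b c * x a * y b * z c) = 0 ∧
        (∑ a, ∑ b, ∑ c, matMulTensor ℂ n n n a b c * x a * y b * z c) = 1 := by
  intro n r S h2n hr hS
  -- below the old window: the sibling stub
  by_cases hr2 : r + 2 ≤ 2 * n
  · exact stub_freeUnitProduct n r S hr2 hS
  -- the new rung `r = 2n - 1 ≥ n`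
  have hn : 0 < n := by omega
  have hnr : n ≤ r := by omega
  obtain ⟨w, u, v, hS'⟩ := exists_eq_sum_triad_of_tensorRank_le hS
  -- two distinct basis directions
  haveI : Nontrivial (Fin n) := Fin.nontrivial_iff_two_le.2 h2n
  obtain ⟨ν₀, ν₁, hν⟩ := exists_pair_ne (Fin n)
  -- THE DETERMINANT STEP: a nontrivial combination of `N_ε i κ := w_i (κ, ν_ε)` with a kernel vector
  obtain ⟨a, b, p₀, hab, hp₀, hker⟩ := exists_combination_mulVec_eq_zero hn
    (Matrix.of fun (i : Fin n) (κ : Fin n) => w (Fin.castLE hnr i) (κ, ν₀))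
    (Matrix.of fun (i : Fin n) (κ : Fin n) => w (Fin.castLE hnr i) (κ, ν₁))
  -- `q₀ := a e_{ν₀} + b e_{ν₁} ≠ 0`
  obtain ⟨q₀, hq₀, hq₀sum⟩ : ∃ q₀ : Fin n → ℂ, q₀ ≠ 0 ∧
      ∀ f : Fin n → ℂ, ∑ ν, f ν * q₀ ν = a * f ν₀ + b * f ν₁ := by
    refine ⟨Pi.single ν₀ a + Pi.single ν₁ b, fun h => ?_, fun f => ?_⟩
    · have h0 : a = 0 := by
        have := congr_fun h ν₀
        rwa [Pi.add_apply, Pi.single_eq_same, Pi.single_eq_of_ne hν, add_zero, Pi.zero_apply] at this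
      have h1 : b = 0 := by
        have := congr_fun h ν₁
        rwa [Pi.add_apply, Pi.single_eq_same, Pi.single_eq_of_ne hν.symm, zero_add, Pi.zero_apply]
          at this
      exact hab.elim (fun ha => ha h0) fun hb => hb h1
    · simp only [Pi.add_apply, mul_add, Finset.sum_add_distrib]
      rw [Fintype.sum_eq_single ν₀ (fun ν hν' => by rw [Pi.single_eq_of_ne hν', mul_zero]),
        Fintype.sum_eq_single ν₁ (fun ν hν' => by rw [Pi.single_eq_of_ne hν', mul_zero]),
        Pi.single_eq_same, Pi.single_eq_same]
      ring
  -- normalise `p₀`, `q₀`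
  obtain ⟨cp, hcp⟩ := exists_unit_mul hp₀
  obtain ⟨cq, hcq⟩ := exists_unit_mul hq₀
  obtain ⟨p, hp, hpdef⟩ : ∃ p : Fin n → ℂ, ∑ κ, ‖p κ‖ ^ 2 = 1 ∧ ∀ κ, p κ = cp * p₀ κ :=
    ⟨fun κ => cp * p₀ κ, hcp, fun _ => rfl⟩
  obtain ⟨q, hq, hqdef⟩ : ∃ q : Fin n → ℂ, ∑ ν, ‖q ν‖ ^ 2 = 1 ∧ ∀ ν, q ν = cq * q₀ ν :=
    ⟨fun ν => cq * q₀ ν, hcq, fun _ => rfl⟩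
  -- `A_l = 0` for `l < n`
  have hpker : ∀ l : Fin r, l.val < n → ∑ κ, (∑ ν, w l (κ, ν) * q ν) * p κ = 0 := by
    intro l hl
    have he : Fin.castLE hnr ⟨l.val, hl⟩ = l := Fin.ext rfl
    have h0 := congr_fun hker ⟨l.val, hl⟩
    simp only [Matrix.mulVec, dotProduct, Matrix.add_apply, Matrix.smul_apply, Matrix.of_apply,
      smul_eq_mul, Pi.zero_apply] at h0
    rw [he] at h0
    -- `h0 : ∑ κ, (a * w l (κ, ν₀) + b * w l (κ, ν₁)) * p₀ κ = 0`
    have h1 : ∑ κ, (∑ ν, w l (κ, ν) * q ν) * p κ =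
        cq * cp * ∑ κ, (a * w l (κ, ν₀) + b * w l (κ, ν₁)) * p₀ κ := by
      rw [Finset.mul_sum]
      refine Finset.sum_congr rfl fun κ _ => ?_
      have h2 : ∑ ν, w l (κ, ν) * q ν = cq * (a * w l (κ, ν₀) + b * w l (κ, ν₁)) := by
        rw [← hq₀sum fun ν => w l (κ, ν), Finset.mul_sum]
        exact Finset.sum_congr rfl fun ν _ => by rw [hqdef]; ring
      rw [h2, hpdef]
      ring
    rw [h1, h0, mul_zero]
  -- `s`: a unit vector killing the functionals `B_l`, `n ≤ l` (at most `r - n ≤ n - 1` of them)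
  have hcard₂ : Fintype.card {l : Fin r // ¬(l.val < n)} < n := by
    have h := Fintype.card_le_of_injective
      (fun l : {l : Fin r // ¬(l.val < n)} =>
        (⟨l.1.val - n, by have := l.2; have := l.1.isLt; omega⟩ : Fin (r - n)))
      (fun l₁ l₂ h => by
        have h' : l₁.1.val - n = l₂.1.val - n := congrArg Fin.val h
        have h₁ := l₁.2
        have h₂ := l₂.2
        exact Subtype.ext (Fin.ext (by omega)))
    rw [Fintype.card_fin] at h
    omega
  obtain ⟨s, hs, hsker⟩ := exists_unit_orth hcard₂
    (fun (l : {l : Fin r // ¬(l.val < n)}) μ => ∑ κ, u l.1 (κ, μ) * conj (p κ))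
  -- the rotated unit product `x = p ⊗ q`, `y = p̄ ⊗ s`, `z = s̄ ⊗ q̄`
  have h1 : ∑ a : Fin n × Fin n, ‖p a.1 * q a.2‖ ^ 2 = 1 :=
    sum_norm_sq_eq_one _ p q (fun a => norm_mul _ _) hp hq
  have h2 : ∑ b : Fin n × Fin n, ‖conj (p b.1) * s b.2‖ ^ 2 = 1 :=
    sum_norm_sq_eq_one _ p s (fun b => by rw [norm_mul, Complex.norm_conj]) hp hs
  have h3 : ∑ c : Fin n × Fin n, ‖conj (s c.1) * conj (q c.2)‖ ^ 2 = 1 :=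
    sum_norm_sq_eq_one _ s q (fun c => by rw [norm_mul, Complex.norm_conj, Complex.norm_conj]) hs hq
  have h4 : ∑ a, ∑ b, ∑ c, S a b c * (p a.1 * q a.2) * (conj (p b.1) * s b.2) *
      (conj (s c.1) * conj (q c.2)) = 0 := by
    rw [hS', ev_sum_triad]
    refine Finset.sum_eq_zero fun l _ => ?_
    by_cases hl : l.val < n
    · -- `A_l = 0`
      have hA : ∑ a : Fin n × Fin n, w l a * (p a.1 * q a.2) = ∑ κ, (∑ ν, w l (κ, ν) * q ν) * p κ := by
        rw [Fintype.sum_prod_type]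
        refine Finset.sum_congr rfl fun κ _ => ?_
        rw [Finset.sum_mul]
        exact Finset.sum_congr rfl fun ν _ => by ring
      rw [hA, hpker l hl, zero_mul, zero_mul]
    · -- `B_l = 0`
      have hB : ∑ b : Fin n × Fin n, u l b * (conj (p b.1) * s b.2) =
          ∑ μ, (∑ κ, u l (κ, μ) * conj (p κ)) * s μ := by
        rw [Fintype.sum_prod_type, Finset.sum_comm]
        refine Finset.sum_congr rfl fun μ _ => ?_
        rw [Finset.sum_mul]
        exact Finset.sum_congr rfl fun κ _ => by ring
      have h0 : ∑ μ, (∑ κ, u l (κ, μ) * conj (p κ)) * s μ = 0 := hsker ⟨l, hl⟩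
      rw [hB, h0, mul_zero, zero_mul]
  have hpC : ∑ κ, (‖p κ‖ : ℂ) ^ 2 = 1 := by exact_mod_cast hp
  have hqC : ∑ ν, (‖q ν‖ : ℂ) ^ 2 = 1 := by exact_mod_cast hq
  have hsC : ∑ μ, (‖s μ‖ : ℂ) ^ 2 = 1 := by exact_mod_cast hs
  have h5 : ∑ a, ∑ b, ∑ c, matMulTensor ℂ n n n a b c * (p a.1 * q a.2) * (conj (p b.1) * s b.2) *
      (conj (s c.1) * conj (q c.2)) = 1 := by
    calc _ = ∑ a : Fin n × Fin n, ∑ μ : Fin n,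
          p a.1 * q a.2 * (conj (p a.1) * s μ) * (conj (s μ) * conj (q a.2)) :=
          ev_matMulTensor (fun a => p a.1 * q a.2) (fun b => conj (p b.1) * s b.2)
            (fun c => conj (s c.1) * conj (q c.2))
      _ = ∑ a : Fin n × Fin n, ∑ μ : Fin n, (‖p a.1‖ : ℂ) ^ 2 * (‖q a.2‖ : ℂ) ^ 2 * (‖s μ‖ : ℂ) ^ 2 := by
          refine Finset.sum_congr rfl fun a _ => Finset.sum_congr rfl fun μ _ => ?_
          rw [← Complex.mul_conj', ← Complex.mul_conj', ← Complex.mul_conj']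
          ring
      _ = (∑ κ, (‖p κ‖ : ℂ) ^ 2) * (∑ ν, (‖q ν‖ : ℂ) ^ 2) * ∑ μ, (‖s μ‖ : ℂ) ^ 2 := by
          rw [Fintype.sum_prod_type, Finset.sum_mul_sum]
          simp_rw [Finset.sum_mul, Finset.mul_sum]
      _ = 1 := by rw [hpC, hqC, hsC, one_mul, one_mul]
  exact ⟨fun a => p a.1 * q a.2, fun b => conj (p b.1) * s b.2, fun c => conj (s c.1) * conj (q c.2),
    h1, h2, h3, h4, h5⟩

end Summit.MatrixMultiplication.MatrixMultiplication.Theorems.LinearDefectLaw.FreeUnitProductDet
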